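import Summits.QuantumAdvantage.QuantumAdvantage.Theorems.ColumnBridgeD
import Summits.QuantumAdvantage.QuantumAdvantage.Theorems.NonDisperseEndA

set_option linter.dupNamespace false
set_option linter.unusedSectionVars false

/-!
# PoolDichotomyA (lens 4, g29; §7 (c) of NODE-g29 — the (c0) DICHOTOMY ON A POOL as ONE kernel theorem, modulo Bogolyubov–Ruzsa)

Blocker `X = AbsorptionDial.NoPerfectPolyOdd` (item 28487); decomp-qadv lens 4, g29.

★ `loss_of_Free_dichotomy` — registers `g ≠ g₀` are `k`-forms, `g₀ = H(labels Λ, quadVal M b)`; labels prepared (`Prepared Λ w₀ U₀`); an unbalanced cut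
`e` (rows) / `T` (pool, `= B`, disjoint from `U₀`) with the cross forms + labels jointly FREE of weight `w` on the pool (`JointFreeness.Free`, kernel Y);
for every bipartition `side` of the pool either its first side is tiny (`≤ r₀`) or the side-dependent threshold `E side` satisfies the three explicit
size conditions; the polynomial-size parameter bounds.  Then some input loses — by cases: SOME non-tiny side disperses (`#lowpairs side ≤ E side`)
⟹ `ColumnBridgeD.loss_of_Free_explicit`; else EVERY side is tiny or non-dispersing ⟹ `NonDisperseEndA.loss_of_allNonDisperse` (modulo `hBR`).

Supports stmt-QuantumAdvantage-28487 (record; the residual `X` is NOT claimed).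
-/

open Finset Module
open Summit.QuantumAdvantage.AdviceFreeQNC0
open Summit.QuantumAdvantage.QuantumAdvantage.Theorems.InnerDegreeDial
open Summit.QuantumAdvantage.QuantumAdvantage.Theorems.BilinearCubeSum
open Summit.QuantumAdvantage.QuantumAdvantage.Theorems.LabelPreparation

namespace Summit.QuantumAdvantage.QuantumAdvantage.Theorems.ColumnBridge

variable {p : ℕ} [Fact p.Prime] {n m : ℕ}

/-- **THE (c0) DICHOTOMY ON A POOL (kernel, modulo Bogolyubov–Ruzsa `hBR`).**  See the module docstring. -/
theorem loss_of_Free_dichotomy (hp5 : 5 ≤ p) (hp3 : p.Coprime 3) {k r : ℕ} (c : ℕ)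
    (y : Fin (n + 1) → (Fin n → Bool) → Bool) (g₀ : Fin (n + 1))
    (lam : Fin (n + 1) → Fin k → Fin n → ZMod p) (F : Fin (n + 1) → (Fin k → ZMod p) → Bool)
    (hF : ∀ g, g ≠ g₀ → ∀ u, y g u = F g (fun j => ∑ i, if u i = true then lam g j i else 0))
    (Λ : Fin k → Fin n → ZMod p) (M : Fin n → Fin n → ZMod p) (b : Fin n → ZMod p)
    (H : (Fin k → ZMod p) → ZMod p → Bool)
    (hy₀ : ∀ u, y g₀ u = H (fun j => ∑ i, if u i = true then Λ j i else 0) (quadVal M b u))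
    (U₀ : Finset (Fin n)) (w₀ : ℕ) (hprep : Prepared Λ w₀ U₀)
    (e : Fin r ↪ Fin n) (T : Fin m ↪ Fin n) (heT : ∀ j i, e j ≠ T i) (B : Finset (Fin n))
    (hTB : ∀ l, l ∈ B ↔ ∃ i, T i = l) (hBU : ∀ l ∈ B, l ∉ U₀)
    (w : ℕ) (hw : w ≤ m) (hcorr : w + (univ.filter fun i : Fin n => i ∉ U₀ ∧ i ∉ B).card ≤ w₀)
    (hFree : JointFreeness.Free (fun (_ : Fin 1) i l => M i l + M l i) Λ B w (univ.map e))
    (w₂ : ℕ) (hwlarge : 4 * p ^ 2 * (3 + (r + k + 1) * p) ≤ w) (hw₂large : 4 * p ^ 2 * (6 + 2 * (r + k + 1) * p) ≤ w₂)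
    (C : ℝ) (hC : 0 ≤ C)
    (hBR : ∀ (n : ℕ) (A : Finset (Fin n → ZMod p)) (α : ℝ), 0 < α → α ≤ 1 → α * (p : ℝ) ^ n ≤ A.card →
      ∃ V : Submodule (ZMod p) (Fin n → ZMod p),
        ((n : ℝ) - finrank (ZMod p) V) ≤ C * (1 + Real.log (1 / α)) ^ 4 ∧
        ∀ v ∈ V, ∃ a₁ ∈ A, ∃ a₂ ∈ A, ∃ a₃ ∈ A, ∃ a₄ ∈ A, v = a₁ + a₂ - a₃ - a₄)
    (h L r₀ : ℕ) (E : (Fin m → Bool) → ℕ)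
    (hr₀ : 8 * h + ⌊C * (1 + L * Real.log p) ^ 4⌋₊ ≤ r₀) (hh : 2 * p ^ 2 * (L * p) ≤ h + 1)
    (hsides : ∀ side : Fin m → Bool, Fintype.card (Side₁ side) ≤ r₀ ∨
      (324 * p ^ (2 * (r + k + 1)) * E side ≤ 4 ^ Fintype.card (Side₁ side) ∧ 0 < E side ∧
        2 * (Fintype.card (Side₂ side) * p + 1) ^ w₂ * 4 ^ Fintype.card (Side₁ side) ≤ E side * p ^ L))
    (t : ℕ) (hm : (2 * p - 1) * t ≤ m) (ht : (n + 1) * (p ^ (k + (6 * r₀ + 1)) * 2) < 2 ^ t)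
    (hcountB : 3 * p ^ k * p ^ k * ((n + 1) * (p ^ k * 2) + 1) < 2 ^ r) :
    ∃ u, ringWinU c y u = false := by
  classical
  by_cases hd : ∃ side : Fin m → Bool, ¬ Fintype.card (Side₁ side) ≤ r₀ ∧
      (univ.filter fun xx : (Side₁ side → Bool) × (Side₁ side → Bool) =>
        (univ.filter fun j => (rowForm (Cx M T side) xx.1 - rowForm (Cx M T side) xx.2) j ≠ 0).card < w₂).card ≤ E side
  · -- a non-tiny dispersing bipartition: the dispersing branch
    obtain ⟨side, hbig, hdisp⟩ := hd
    rcases hsides side with htiny | ⟨hE, _, _⟩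
    · exact (hbig htiny).elim
    have ht' : (n + 1) * (p ^ k * 2) < 2 ^ t := by
      have hp0 : 0 < p := by omega
      have : p ^ k ≤ p ^ (k + (6 * r₀ + 1)) := Nat.pow_le_pow_right hp0 (by omega)
      calc (n + 1) * (p ^ k * 2) ≤ (n + 1) * (p ^ (k + (6 * r₀ + 1)) * 2) :=
            Nat.mul_le_mul_left _ (Nat.mul_le_mul_right _ this)
        _ < 2 ^ t := ht
    exact loss_of_Free_explicit hp5 hp3 c y g₀ lam F hF Λ M b H hy₀ U₀ w₀ hprep e T heT B hTB hBU side w hw hcorr hFree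
      w₂ (E side) hdisp hwlarge hw₂large hE t hm ht' hcountB
  · -- every bipartition tiny or non-dispersing: the non-dispersing end
    push Not at hd
    have hall : ∀ side : Fin m → Bool, Fintype.card (Side₁ side) ≤ r₀ ∨
        (0 < E side ∧ 2 * (Fintype.card (Side₂ side) * p + 1) ^ w₂ * 4 ^ Fintype.card (Side₁ side) ≤ E side * p ^ L ∧
          E side < (univ.filter fun xx : (Side₁ side → Bool) × (Side₁ side → Bool) =>
            (univ.filter fun j => (rowForm (Cx M T side) xx.1 - rowForm (Cx M T side) xx.2) j ≠ 0).card < w₂).card) := by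
      intro side
      rcases hsides side with htiny | ⟨_, hpos, hEL⟩
      · exact Or.inl htiny
      by_cases htiny : Fintype.card (Side₁ side) ≤ r₀
      · exact Or.inl htiny
      exact Or.inr ⟨hpos, hEL, hd side (by omega)⟩
    obtain ⟨v, hv⟩ := loss_of_allNonDisperse hp5 c y g₀ lam F hF Λ M b H hy₀ (fun _ => false) T C hC hBR w₂ h L r₀ E hr₀ hh hall
      (DisperseArithmetic.hcountA_of (by omega) hm ht)
    exact ⟨_, hv⟩

end Summit.QuantumAdvantage.QuantumAdvantage.Theorems.ColumnBridge
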